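import Summits.CriticalPhenomena.Ising3DConformalLimit.Theorems.IsingEuclidUpgradeIsingEuclidUpgradeR2RotInvPowerLawRayRigidity
import Literature.Probability.LatticeModels.PointwiseScalingLimitEtaExists
import HarnessLib

/-!
# Crux `IsingEuclidUpgradeR2RotInvPowerLaw` (stmt-CriticalPhenomena-0634), line `tower_profile_rigidity`:
# stub R `stub_rigidityTransfer` — axis dilation law + angular profile force RATIO ISOTROPY

Write `G := criticalTwoPoint 3` for the critical two-point function `⟨σ₀σ_x⟩_{β_c}` of the
nearest-neighbour Ising model on `ℤ³`, `g(n) := G(n e₀)`, `|x|₂ := √(∑ xᵢ²)`, `N(x) := ⌊|x|₂⌋` and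
`x̂ := x / |x|₂`.

**Theorem** (`stub_rigidityTransfer`, the registered stub R of the line, verbatim). For every `Δ` and
every `Ψ : ℝ³ → ℝ`: if
1. (integer dilation law on the axis) `g(kn) k^{2Δ} / g(n) → 1` for every `k ≥ 1`;
2. (uniform dilation law) `g(m_i) (m_i/b_i)^{2Δ} / g(b_i) → 1` whenever `b_i → ∞` and eventually
   `b_i ≤ m_i ≤ 2 b_i`;
3. `Ψ` is continuous on the unit sphere (carried, not used) and
4. positive on the unit sphere;
5. (angular profile) `G(x)/g(N x) − Ψ(x̂) → 0` cofinitely on `ℤ³`;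
then `G(x)/g(N x) → 1` cofinitely (ratio isotropy S3).

Proof. By the LANDED ray rigidity transfer `stub_rayRigidityTransfer` (p165602: ray regular variation
⇒ pinned pair zoom converges to `‖z₁ − z₀‖^{-2Δ}` by nine-mirror reflection-positivity rigidity ⇒ ratio
isotropy) it suffices to derive the RAY dilation law `G(knv) k^{2Δ}/G(nv) → 1` along every lattice ray
`ℤv`, `v ≠ 0`. Along the ray the direction `x̂` is the constant `v̂`, so hypothesis 5 pulled back along
the (injective) ray gives `G(nv)/g(b_n) → Ψ(v̂) > 0` and `G(knv)/g(m_n) → Ψ(v̂)` with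
`b_n := N(nv) = ⌊n|v|₂⌋ → ∞`, `m_n := N(knv) = ⌊kn|v|₂⌋`, and `k b_n ≤ m_n < k b_n + k`. Hypothesis 1
along `b_n` gives `g(k b_n) k^{2Δ}/g(b_n) → 1`; hypothesis 2 with base `k b_n` and `m_n/(k b_n) → 1`
gives `g(m_n)/g(k b_n) → 1`. Multiplying the four ratios,
`G(knv) k^{2Δ}/G(nv) = [G(knv)/g(m_n)]·[g(m_n)/g(k b_n)]·[g(k b_n)k^{2Δ}/g(b_n)]·[g(b_n)/G(nv)]
 → Ψ(v̂)·1·1·Ψ(v̂)⁻¹ = 1`.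

References: H. Duminil-Copin, ICM 2022, §8.1 (rotation invariance of the critical two-point function
on `ℤ³` is postulated) [DuminilCopinICM2022]. No definitions are introduced.
-/

noncomputable section

namespace Summit.CriticalPhenomena.Ising3DConformalLimit.Cruxes.IsingEuclidUpgradeR2RotInvPowerLaw.TowerProfileRigidity

open Filter Topology Set Literature.Probability.LatticeModels
open Summit.CriticalPhenomena.Ising3DConformalLimit.Theorems.KernelTransfer (tendsto_sqrt_sum_sq_cofinite)

/-- Coordinates of the ray point `n v`, cast to `ℝ`: `(n v)_i = n v_i`. [folklore] -/
theorem intCast_natSmul_apply (v : Site 3) (n : ℕ) (i : Fin 3) :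
    (((((n : ℕ) : ℤ) • v) i : ℤ) : ℝ) = (n : ℝ) * (v i : ℝ) := by
  simp [Pi.smul_apply]

/-- Euclidean length scales along a lattice ray: `|n v|₂ = n |v|₂`. [folklore] -/
theorem sqrt_sum_sq_natSmul (v : Site 3) (n : ℕ) :
    Real.sqrt (∑ i, (((((n : ℕ) : ℤ) • v) i : ℝ)) ^ 2) =
      (n : ℝ) * Real.sqrt (∑ i, ((v i : ℝ)) ^ 2) := by
  simp_rw [intCast_natSmul_apply, mul_pow, ← Finset.mul_sum]
  rw [Real.sqrt_mul (sq_nonneg _), Real.sqrt_sq (Nat.cast_nonneg _)]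

/-- A nonzero lattice vector has positive Euclidean length. [folklore] -/
theorem sqrt_sum_sq_pos_of_ne_zero (v : Site 3) (hv : v ≠ 0) :
    0 < Real.sqrt (∑ i, ((v i : ℝ)) ^ 2) := by
  obtain ⟨i, hi⟩ := Function.ne_iff.1 hv
  have hi' : (v i : ℝ) ≠ 0 := by exact_mod_cast hi
  refine Real.sqrt_pos.2 (Finset.sum_pos' (fun j _ => sq_nonneg _) ⟨i, Finset.mem_univ i, ?_⟩)
  positivity

/-- The lattice ray `n ↦ n v`, `v ≠ 0`, is injective, hence escapes every finite set. [folklore] -/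
theorem tendsto_natSmul_cofinite (v : Site 3) (hv : v ≠ 0) :
    Tendsto (fun n : ℕ => ((n : ℕ) : ℤ) • v) atTop cofinite := by
  have hinj : Function.Injective (fun n : ℕ => ((n : ℕ) : ℤ) • v) := by
    obtain ⟨i, hi⟩ := Function.ne_iff.1 hv
    intro a b hab
    have h := congr_fun hab i
    simp only [Pi.smul_apply, zsmul_eq_mul] at h
    exact_mod_cast mul_right_cancel₀ hi h
  rw [← Nat.cofinite_eq_atTop]
  exact hinj.tendsto_cofinite

/-- Floor sandwich, lower half: `k ⌊t⌋ ≤ ⌊k t⌋` for `t ≥ 0`. [folklore] -/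
theorem mul_nat_floor_le_floor_mul (k : ℕ) {t : ℝ} (ht : 0 ≤ t) : k * ⌊t⌋₊ ≤ ⌊(k : ℝ) * t⌋₊ := by
  refine Nat.le_floor ?_
  push_cast
  exact mul_le_mul_of_nonneg_left (Nat.floor_le ht) (Nat.cast_nonneg k)

/-- Floor sandwich, upper half: `⌊k t⌋ < k ⌊t⌋ + k` for `t ≥ 0`, `k ≥ 1`. [folklore] -/
theorem floor_mul_lt_mul_nat_floor_add {k : ℕ} (hk : 1 ≤ k) {t : ℝ} (ht : 0 ≤ t) :
    ⌊(k : ℝ) * t⌋₊ < k * ⌊t⌋₊ + k := by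
  rw [Nat.floor_lt (by positivity)]
  push_cast
  have h1 : t < (⌊t⌋₊ : ℝ) + 1 := Nat.lt_floor_add_one t
  have hk0 : (0 : ℝ) < k := by exact_mod_cast hk
  nlinarith

/-- **The ray dilation law from the axis dilation law and an angular profile.** If the axis sequence
`g` obeys the integer dilation law `g(kn)k^{2Δ}/g(n) → 1` and its uniform version on windows `[b, 2b]`,
and `G(x)/g(⌊|x|₂⌋) − Ψ(x̂) → 0` cofinitely for some `Ψ` positive on the unit sphere, then along every
lattice ray `ℤv`, `v ≠ 0`, the dilation law `G(knv)k^{2Δ}/G(nv) → 1` holds for every `k ≥ 1`.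
[cite: DuminilCopinICM2022, §8.1] -/
theorem rayDilationLaw_of_axisLaw_of_profile {Δ : ℝ} {Ψ : (Fin 3 → ℝ) → ℝ}
    (hS : ∀ k : ℕ, 1 ≤ k → Tendsto (fun n : ℕ => criticalTwoPoint 3 (Pi.single 0 ((k * n : ℕ) : ℤ)) *
      (k : ℝ) ^ (2 * Δ) / criticalTwoPoint 3 (Pi.single 0 ((n : ℕ) : ℤ))) atTop (𝓝 1))
    (hU : ∀ b m : ℕ → ℕ, Tendsto b atTop atTop → (∀ᶠ i in atTop, b i ≤ m i ∧ m i ≤ 2 * b i) →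
      Tendsto (fun i : ℕ => criticalTwoPoint 3 (Pi.single 0 ((m i : ℕ) : ℤ)) *
        ((m i : ℝ) / (b i : ℝ)) ^ (2 * Δ) / criticalTwoPoint 3 (Pi.single 0 ((b i : ℕ) : ℤ)))
        atTop (𝓝 1))
    (hΨ : ∀ u : Fin 3 → ℝ, ∑ i, u i ^ 2 = 1 → 0 < Ψ u)
    (hA : Tendsto (fun x : Site 3 => criticalTwoPoint 3 x /
      criticalTwoPoint 3 (Pi.single 0 ((⌊Real.sqrt (∑ i, ((x i : ℝ)) ^ 2)⌋₊ : ℕ) : ℤ)) -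
        Ψ (fun i => (x i : ℝ) / Real.sqrt (∑ j, ((x j : ℝ)) ^ 2))) cofinite (𝓝 0))
    (v : Site 3) (hv : v ≠ 0) (k : ℕ) (hk : 1 ≤ k) :
    Tendsto (fun n : ℕ => criticalTwoPoint 3 (((k * n : ℕ) : ℤ) • v) * (k : ℝ) ^ (2 * Δ) /
      criticalTwoPoint 3 (((n : ℕ) : ℤ) • v)) atTop (𝓝 1) := by
  -- notation
  set E : Site 3 → ℝ := fun x => Real.sqrt (∑ i, ((x i : ℝ)) ^ 2) with hE
  set g : ℕ → ℝ := fun n => criticalTwoPoint 3 (Pi.single 0 ((n : ℕ) : ℤ)) with hg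
  -- positivity of the two-point function
  have hGpos : ∀ x : Site 3, 0 < criticalTwoPoint 3 x := by
    intro x
    by_cases hx : x = 0
    · rw [hx, criticalTwoPoint_zero']
      exact one_pos
    · obtain ⟨c, C, hc, hbd⟩ := criticalTwoPoint_bounds_holds (d := 3) (by norm_num)
      exact lt_of_lt_of_le (mul_pos hc (Real.rpow_pos_of_pos (norm_pos_iff.2 hx) _)) (hbd _ hx).1
  have hgpos : ∀ n : ℕ, 0 < g n := fun n => criticalTwoPoint_axis_pos n
  have hk0 : (0 : ℝ) < k := by exact_mod_cast hk
  -- the ray, its length and its direction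
  have hray : Tendsto (fun n : ℕ => ((n : ℕ) : ℤ) • v) atTop cofinite := tendsto_natSmul_cofinite v hv
  have hEv : 0 < E v := sqrt_sum_sq_pos_of_ne_zero v hv
  have hEn : ∀ n : ℕ, E (((n : ℕ) : ℤ) • v) = (n : ℝ) * E v := fun n => sqrt_sum_sq_natSmul v n
  have hEkn : ∀ n : ℕ, E (((k * n : ℕ) : ℤ) • v) = (k : ℝ) * E (((n : ℕ) : ℤ) • v) := by
    intro n
    rw [hEn, hEn]
    push_cast
    ring
  set vhat : Fin 3 → ℝ := fun i => (v i : ℝ) / E v with hvhat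
  have hvhat1 : ∑ i, vhat i ^ 2 = 1 := by
    simp only [hvhat, div_pow]
    rw [← Finset.sum_div, Real.sq_sqrt (Finset.sum_nonneg fun i _ => sq_nonneg _)]
    exact div_self (by
      have := Real.sqrt_pos.1 hEv
      exact this.ne')
  have hL : 0 < Ψ vhat := hΨ vhat hvhat1
  have hdir : ∀ n : ℕ, 1 ≤ n →
      (fun i => (((((n : ℕ) : ℤ) • v) i : ℤ) : ℝ) / E (((n : ℕ) : ℤ) • v)) = vhat := by
    intro n hn
    have hn0 : (n : ℝ) ≠ 0 := by exact_mod_cast (Nat.one_le_iff_ne_zero.1 hn)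
    funext i
    rw [hEn n, intCast_natSmul_apply]
    exact mul_div_mul_left _ _ hn0
  -- the two integer scales `b_n := ⌊|nv|₂⌋`, `m_n := ⌊|knv|₂⌋`
  set b : ℕ → ℕ := fun n => ⌊E (((n : ℕ) : ℤ) • v)⌋₊ with hb
  set m : ℕ → ℕ := fun n => ⌊E (((k * n : ℕ) : ℤ) • v)⌋₊ with hm
  have hkn : Tendsto (fun n : ℕ => k * n) atTop atTop :=
    tendsto_atTop_mono (fun n => Nat.le_mul_of_pos_left n hk) tendsto_id
  -- step 1: the profile along the ray, `G(nv)/g(b_n) → Ψ(v̂)` and `G(knv)/g(m_n) → Ψ(v̂)`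
  have h2 : Tendsto (fun n : ℕ => criticalTwoPoint 3 (((n : ℕ) : ℤ) • v) / g (b n)) atTop
      (𝓝 (Ψ vhat)) := by
    have h := (hA.comp hray).add_const (Ψ vhat)
    rw [zero_add] at h
    refine h.congr' ?_
    filter_upwards [eventually_ge_atTop 1] with n hn
    simp only [Function.comp_apply]
    rw [hdir n hn]
    ring
  have h2k : Tendsto (fun n : ℕ => criticalTwoPoint 3 (((k * n : ℕ) : ℤ) • v) / g (m n)) atTop
      (𝓝 (Ψ vhat)) := h2.comp hkn
  -- step 2: `b_n → ∞` and the sandwich `k b_n ≤ m_n < k b_n + k`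
  have hb_top : Tendsto b atTop atTop :=
    (tendsto_nat_floor_atTop.comp (tendsto_sqrt_sum_sq_cofinite 3)).comp hray
  have hkb_top : Tendsto (fun n => k * b n) atTop atTop := hkn.comp hb_top
  have hkb : ∀ n, k * b n ≤ m n := by
    intro n
    show k * ⌊E (((n : ℕ) : ℤ) • v)⌋₊ ≤ ⌊E (((k * n : ℕ) : ℤ) • v)⌋₊
    rw [hEkn n]
    exact mul_nat_floor_le_floor_mul k (Real.sqrt_nonneg _)
  have hmk : ∀ n, m n < k * b n + k := by
    intro n
    show ⌊E (((k * n : ℕ) : ℤ) • v)⌋₊ < k * ⌊E (((n : ℕ) : ℤ) • v)⌋₊ + k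
    rw [hEkn n]
    exact floor_mul_lt_mul_nat_floor_add hk (Real.sqrt_nonneg _)
  have hb1 : ∀ᶠ n in atTop, 1 ≤ b n := hb_top.eventually (eventually_ge_atTop 1)
  have hsand : ∀ᶠ n in atTop, k * b n ≤ m n ∧ m n ≤ 2 * (k * b n) := by
    filter_upwards [hb1] with n hn
    refine ⟨hkb n, ?_⟩
    have h1 := hmk n
    have h2 : k ≤ k * b n := Nat.le_mul_of_pos_right k hn
    omega
  -- step 3: hypothesis 1 along `b_n`
  have h3 : Tendsto (fun n => g (k * b n) * (k : ℝ) ^ (2 * Δ) / g (b n)) atTop (𝓝 1) :=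
    (hS k hk).comp hb_top
  -- step 4: hypothesis 2 with base `k b_n` and `m_n`, and `m_n/(k b_n) → 1`
  have h5 : Tendsto (fun n => g (m n) * (((m n : ℕ) : ℝ) / ((k * b n : ℕ) : ℝ)) ^ (2 * Δ) /
      g (k * b n)) atTop (𝓝 1) := hU (fun n => k * b n) m hkb_top hsand
  have hratio : Tendsto (fun n => ((m n : ℕ) : ℝ) / ((k * b n : ℕ) : ℝ)) atTop (𝓝 1) := by
    have hup : Tendsto (fun n => (1 : ℝ) + 1 / ((b n : ℕ) : ℝ)) atTop (𝓝 1) := by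
      have h := (tendsto_one_div_atTop_nhds_zero_nat.comp hb_top).const_add (1 : ℝ)
      rw [add_zero] at h
      exact h
    refine tendsto_of_tendsto_of_tendsto_of_le_of_le' tendsto_const_nhds hup ?_ ?_
    · filter_upwards [hb1] with n hn
      have hkb0 : (0 : ℝ) < ((k * b n : ℕ) : ℝ) := by
        have : 1 ≤ k * b n := Nat.le_mul_of_pos_right k hn |>.trans' hk
        exact_mod_cast this
      rw [le_div_iff₀ hkb0, one_mul]
      exact_mod_cast hkb n
    · filter_upwards [hb1] with n hn
      have hb0 : (0 : ℝ) < ((b n : ℕ) : ℝ) := by exact_mod_cast hn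
      have hkb0 : (0 : ℝ) < ((k * b n : ℕ) : ℝ) := by push_cast; positivity
      rw [div_le_iff₀ hkb0]
      have h1 : ((m n : ℕ) : ℝ) < (k : ℝ) * ((b n : ℕ) : ℝ) + k := by exact_mod_cast hmk n
      have h2 : (1 + 1 / ((b n : ℕ) : ℝ)) * ((k * b n : ℕ) : ℝ) = (k : ℝ) * ((b n : ℕ) : ℝ) + k := by
        push_cast
        field_simp
      rw [h2]
      exact h1.le
  have h6 : Tendsto (fun n => (((m n : ℕ) : ℝ) / ((k * b n : ℕ) : ℝ)) ^ (2 * Δ)) atTop (𝓝 1) := by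
    have h := hratio.rpow_const (p := 2 * Δ) (Or.inl one_ne_zero)
    rwa [Real.one_rpow] at h
  have h7 : Tendsto (fun n => g (m n) / g (k * b n)) atTop (𝓝 1) := by
    have h := h5.div h6 one_ne_zero
    rw [div_one] at h
    refine h.congr' ?_
    filter_upwards [hb1] with n hn
    have hb0 : (0 : ℝ) < ((b n : ℕ) : ℝ) := by exact_mod_cast hn
    have hkb0 : (0 : ℝ) < ((k * b n : ℕ) : ℝ) := by push_cast; positivity
    have hm0 : (0 : ℝ) < ((m n : ℕ) : ℝ) := by
      have : 1 ≤ m n := (hkb n).trans' (Nat.le_mul_of_pos_right k hn |>.trans' hk)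
      exact_mod_cast this
    have hr : (0 : ℝ) < (((m n : ℕ) : ℝ) / ((k * b n : ℕ) : ℝ)) ^ (2 * Δ) :=
      Real.rpow_pos_of_pos (div_pos hm0 hkb0) _
    have hg1 := (hgpos (k * b n)).ne'
    simp only [Pi.div_apply]
    field_simp
  -- step 5: the reciprocal profile limit `g(b_n)/G(nv) → Ψ(v̂)⁻¹`
  have h8 : Tendsto (fun n : ℕ => g (b n) / criticalTwoPoint 3 (((n : ℕ) : ℤ) • v)) atTop
      (𝓝 (Ψ vhat)⁻¹) := by
    have h := h2.inv₀ hL.ne'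
    refine h.congr fun n => ?_
    rw [inv_div]
  -- assemble the four ratios
  have hprod := ((h2k.mul h7).mul h3).mul h8
  have hlim : Ψ vhat * 1 * 1 * (Ψ vhat)⁻¹ = 1 := by
    rw [mul_one, mul_one, mul_inv_cancel₀ hL.ne']
  rw [hlim] at hprod
  refine hprod.congr fun n => ?_
  have hg1 := (hgpos (m n)).ne'
  have hg2 := (hgpos (k * b n)).ne'
  have hg3 := (hgpos (b n)).ne'
  have hG := (hGpos (((n : ℕ) : ℤ) • v)).ne'
  simp only [hm, hb] at hg1 hg2 hg3 ⊢
  field_simp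

/-- **R (rigidity transfer), the registered stub `stub_rigidityTransfer` of line
`tower_profile_rigidity`, verbatim.** For every exponent `Δ` and every candidate angular profile `Ψ`:
the integer dilation law of the critical axis two-point sequence at `Δ`, its uniform version on
windows `[b, 2b]`, continuity and positivity of `Ψ` on the unit sphere, and convergence of
`⟨σ₀σ_x⟩_{β_c}/⟨σ₀σ_{⌊|x|₂⌋e₀}⟩_{β_c} − Ψ(x/|x|₂) → 0` together force ratio isotropy
`⟨σ₀σ_x⟩_{β_c}/⟨σ₀σ_{⌊|x|₂⌋e₀}⟩_{β_c} → 1` cofinitely on `ℤ³` — i.e. the lattice cannot settle on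
a non-constant angular profile. Reduction to the landed ray rigidity transfer
`stub_rayRigidityTransfer` via `rayDilationLaw_of_axisLaw_of_profile`. [cite: DuminilCopinICM2022, §8.1] -/
theorem stub_rigidityTransfer :
    ∀ (Δ : ℝ) (Ψ : (Fin 3 → ℝ) → ℝ), (∀ k : ℕ, 1 ≤ k → Filter.Tendsto (fun n : ℕ => Literature.Probability.LatticeModels.criticalTwoPoint 3 (Pi.single 0 ((k * n : ℕ) : ℤ)) * (k : ℝ) ^ (2 * Δ) / Literature.Probability.LatticeModels.criticalTwoPoint 3 (Pi.single 0 ((n : ℕ) : ℤ))) Filter.atTop (nhds 1)) → (∀ b m : ℕ → ℕ, Filter.Tendsto b Filter.atTop Filter.atTop → (∀ᶠ i in Filter.atTop, b i ≤ m i ∧ m i ≤ 2 * b i) → Filter.Tendsto (fun i : ℕ => Literature.Probability.LatticeModels.criticalTwoPoint 3 (Pi.single 0 ((m i : ℕ) : ℤ)) * ((m i : ℝ) / (b i : ℝ)) ^ (2 * Δ) / Literature.Probability.LatticeModels.criticalTwoPoint 3 (Pi.single 0 ((b i : ℕ) : ℤ))) Filter.atTop (nhds 1)) → ContinuousOn Ψ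 {u : Fin 3 → ℝ | ∑ i, u i ^ 2 = 1} → (∀ u : Fin 3 → ℝ, ∑ i, u i ^ 2 = 1 → 0 < Ψ u) → Filter.Tendsto (fun x : Literature.Probability.LatticeModels.Site 3 => Literature.Probability.LatticeModels.criticalTwoPoint 3 x / Literature.Probability.LatticeModels.criticalTwoPoint 3 (Pi.single 0 ((⌊Real.sqrt (∑ i, ((x i : ℝ)) ^ 2)⌋₊ : ℕ) : ℤ)) - Ψ (fun i => (x i : ℝ) / Real.sqrt (∑ j, ((x j : ℝ)) ^ 2))) Filter.cofinite (nhds 0) → Filter.Tendsto (fun x : Literature.Probability.LatticeModels.Site 3 => Literature.Probability.LatticeModels.criticalTwoPoint 3 x / Literature.Probability.LatticeModels.criticalTwoPoint 3 (Pi.single 0 ((⌊Real.sqrt (∑ i, ((x i : ℝ)) ^ 2)⌋₊ : ℕ) : ℤ))) Filter.cofinite (nhds 1) := by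
  intro Δ Ψ hS hU _hΨc hΨ hA
  exact stub_rayRigidityTransfer Δ
    (fun v hv k hk => rayDilationLaw_of_axisLaw_of_profile hS hU hΨ hA v hv k hk) hU

end Summit.CriticalPhenomena.Ising3DConformalLimit.Cruxes.IsingEuclidUpgradeR2RotInvPowerLaw.TowerProfileRigidity

end
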